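import Literature.MathematicalPhysics.QuantumFieldTheory.BalabanImbrieJaffe1984to88.BIJ88ConnectedGraphResummation
import Literature.MathematicalPhysics.QuantumFieldTheory.Dimock2011to13.TreeGraphSummation

/-!
# `BalabanImbrieJaffe1984to88.BIJ88ConnectedGraphTreeBound` — T. Bałaban, J. Imbrie, A. Jaffe, *Effective action and cluster properties of the
abelian Higgs model*, Commun. Math. Phys. **114** (1988) 257–315 [BalabanImbrieJaffe1988], Sect. 5.14, p. 310 [PDF 54]: **the connected series of
display 3 (`G_c` over connected graphs) converges absolutely and its sum is bounded, IN ANY BOOKKEEPING, under tree-graph hypotheses** — the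
GENERIC half of *"It is now a standard exercise to estimate the expansion, using (5.14.4)"* for the ordered connected sums `Tord`/`Tsum` of
`BIJ88ConnectedGraphResummation` (p25 gen 6), whose displays 1–3 carry the displayed hypothesis `hT` (*absolute convergence of the connected
series of every nonempty sub-collection*).  p25's `BIJ88RemainderW6Prime.summable_norm_Tord` discharged `hT` for gens 5/6's plain bookkeeping
`polys R Λ` only (connected cube polymers, volume = cardinality); the cluster-configuration gas of the actual expansion (5.14.3) lives on the
VIRTUAL SUPPORTS of `BIJ88Expansion5143Ordered` (`(polysOf W).image (cvsupp adj W)`), whose cardinality is not a usable volume — hence the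
general-volume form proved here (sibling `BIJ88ConnectedGraphKP310` instantiates it and reads the activity bound off (5.14.4)).

statement-level skeleton of published theorems with citation tags; proofs where landed; nothing here is a claim about the Yang–Mills mass gap

PDF held: `paper:balaban1988-cmp114-bij-abelian-higgs-effective-action` (journal page = PDF page + 256); p. 310 = PDF 54 read this session
(`p0054.txt` L14–19: display 3, *"where Gc runs over connected graphs involving all clusters X_γ, Y_δ, and hence all of H"*; L25: *"It is now a
standard exercise to estimate the expansion, using (5.14.4). The result is"*).

WHAT IS REPRODUCED (unit `lit-balaban-p36`, generation 11 of the Phase-2 proof seat p36, file 1 of 3; SKELETON rows **C2.Claim@310** (the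
*"standard exercise"* sentence for the display-3 truncated functions, member) and **C2.Eq5.14.1-5.14.2** / **C2.Eq5.14.3-5.14.4** (members) of
`HOME/lit-balaban-r16/ROWS-C2-part2.md`; owner r16, heads untouched; HOME `run/shared/lean/pub/lit-balaban/`).  Setting of
`BIJ88ConnectedGraphResummation` verbatim: cube type `V`, slot type `S`, polymer family `Q : Finset (Finset V)` (hard core = disjointness),
localization `loc : S → V`, activity `w : Finset S → Finset V → ℝ`; `Traw Q loc w (Fin m) b`, `Tord Q loc w m b = Traw/m!`, `Tsum = Σ_m Tord`.
Theorems only (0 definitions):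
* `card_filter_owp_le` — the labelled structures (ordered weak partitions `(H_i)_{i<m}` of the block `b`, *"no duplication of t-derivatives"*)
  number `≤ m^{|b|} ≤ |b|!·e^m` (injective carrier map; cf. p25's `BIJ88RemainderW6Prime.card_owp_cov_le`, which bounds by `|b|!·e^{Σ|Z_i|}` — too
  large when `|Z_i|` is a virtual cardinality);
* `abs_wprod_le`, **`abs_Traw_le_of_actBound`** — steps (a)–(c): an activity bound `|w(H, Z)| ≤ M^{|H|}·u(Z)` on `Q` (`M, u ≥ 0`) gives
  `|Traw_m(b)| ≤ M^{|b|}·|b|!·Σ_{Z∈Q^m} |ρ^T(Z)|·Π_i (e·u(Z_i))` (`m^{|b|} ≤ |b|!·e^m`, one factor `e` per cluster);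
* **`sum_abs_Tord_le_of_treeHyp`**, **`summable_norm_Tord_of_treeHyp`**, **`abs_Tsum_le_of_treeHyp`** — step (d): with Dimock's tree-graph
  hypotheses for the weight `e·u` and ANY volume `vol ≥ 0` (vertex `Σ_{X∈Q: X∩X′≠∅} e·u(X)vol(X)^k ≤ k!·A·vol(X′)`, root `Σ_{X∈Q} e·u(X)vol(X)^k ≤
  k!·A·B`, `A ≤ 1/8`; engine `Dimock2011to13.TreeGraphSummation.hstar_partialSum_le` = Penrose's tree-graph inequality + the tuple summation,
  [Dimock2013] App. B): `Σ_{m<N} |Tord_m(b)| ≤ M^{|b|}·|b|!·2AB` for every nonempty `b`, hence `Σ_m ‖Tord_m(b)‖` summable (= the hypothesis `hT`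
  of `BIJ88ConnectedGraphResummation.display3` / `BIJ88RemainderW6Tsum.display2_Tsum` / `BIJ88SlotConnectedGraph310`) and `|T(b)| ≤ M^{|b|}·|b|!·2AB`.
HONEST SCOPE: finite combinatorics and absolutely convergent real series; no statement about the paper beyond the cited sentence; the constants
are not optimized; (5.14.4) is not used here (sibling file).  0 `sorry`, 0 definitions, 0 new `Prop` facts (D-0026); imports
`BIJ88ConnectedGraphResummation`, `Dimock2011to13.TreeGraphSummation` only; modifies nothing.  NOT summit progress; NOT continuum; NOT Clay.
Cell `lit-balaban` Phase 2, seat p36 gen 11 (owner r16, referee ref-5).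
-/

noncomputable section

namespace Literature.MathematicalPhysics.QuantumFieldTheory.BalabanImbrieJaffe1984to88.BIJ88ConnectedGraphTreeBound

open Finset
open Literature.MathematicalPhysics.QuantumFieldTheory.Dimock2011to13.UrsellTreeGraphBound (rhoT)
open Literature.MathematicalPhysics.QuantumFieldTheory.Dimock2011to13.TreeGraphSummation (hstar_partialSum_le)
open BIJ88ConnectedGraphResummation (OWP InQ Cov wprod Traw Tord Tsum Tord_zero exists_carrier carrier_unique)

variable {V : Type*} {S : Type*} [DecidableEq V] [Fintype V] [DecidableEq S] [Fintype S]
  {Q : Finset (Finset V)} {loc : S → V} {w : Finset S → Finset V → ℝ}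

/-! ## §1 Counting the labelled structures; the activity product along a labelled family -/

omit [DecidableEq V] [Fintype V] in
/-- the tuples of polymers of `Q` are the tuples satisfying `InQ Q`. [cite: BalabanImbrieJaffe1988, p.310 (Sect. 5.14)] -/
theorem piFinset_eq_filter_inQ [DecidableEq V] [Fintype V] {m : ℕ} (Q : Finset (Finset V)) :
    Fintype.piFinset (fun _ : Fin m => Q) = univ.filter fun Z => InQ Q Z := by
  ext Z
  simp only [Fintype.mem_piFinset, mem_filter, mem_univ, true_and]
  rfl

omit [DecidableEq V] [Fintype V] in
/-- **the labelled structures on a sub-collection `b` number at most `m^{|b|}`**: an ordered weak partition `(H_i)_{i<m}` of `b`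
(*"the corresponding subsets of H … no duplication of t-derivatives"*, p. 310) is determined by the slot `i ∈ Fin m` carrying each `j ∈ b`
(the carrier map `H ↦ (j ↦ {i : j ∈ H_i})` is injective). [cite: BalabanImbrieJaffe1988, p.310 (Sect. 5.14)] -/
theorem card_filter_owp_le (b : Finset S) (m : ℕ) :
    ((univ : Finset (Fin m → Finset S)).filter fun Hs => OWP b Hs).card ≤ m ^ b.card := by
  classical
  set A := (univ : Finset (Fin m → Finset S)).filter fun Hs => OWP b Hs with hA
  set car : (Fin m → Finset S) → S → Finset (Fin m) := fun Hs j => univ.filter fun i => j ∈ Hs i with hcar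
  set tgt : S → Finset (Finset (Fin m)) := fun j =>
    if j ∈ b then (univ : Finset (Fin m)).image (fun i => ({i} : Finset (Fin m))) else {∅} with htgt
  have hmaps : Set.MapsTo car A (Fintype.piFinset tgt) := by
    intro Hs hHs
    have howp : OWP b Hs := (mem_filter.1 (mem_coe.1 hHs)).2
    refine mem_coe.2 (Fintype.mem_piFinset.2 fun j => ?_)
    by_cases hj : j ∈ b
    · obtain ⟨i, hi⟩ := exists_carrier howp hj
      have heq : car Hs j = {i} := by
        ext i'
        simp only [hcar, mem_filter, mem_univ, true_and, mem_singleton]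
        exact ⟨fun h => carrier_unique howp h hi, fun h => h ▸ hi⟩
      have ht : tgt j = (univ : Finset (Fin m)).image (fun i => ({i} : Finset (Fin m))) := if_pos hj
      rw [ht, heq]
      exact mem_image_of_mem _ (mem_univ i)
    · have heq : car Hs j = ∅ := by
        refine filter_eq_empty_iff.2 fun i _ hji => hj ?_
        have : j ∈ univ.biUnion Hs := mem_biUnion.2 ⟨i, mem_univ _, hji⟩
        rwa [howp.2] at this
      have ht : tgt j = {∅} := if_neg hj
      rw [ht, heq]
      exact mem_singleton_self _
  have hinj : Set.InjOn car A := by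
    intro Hs₁ _ Hs₂ _ h
    funext i
    ext j
    have h1 : i ∈ car Hs₁ j ↔ i ∈ car Hs₂ j := by rw [h]
    simpa [hcar] using h1
  calc A.card ≤ (Fintype.piFinset tgt).card := card_le_card_of_injOn car hmaps hinj
    _ = ∏ j, (tgt j).card := Fintype.card_piFinset tgt
    _ = ∏ j, (if j ∈ b then m else 1) := prod_congr rfl fun j _ => by
        by_cases hj : j ∈ b
        · have ht : tgt j = (univ : Finset (Fin m)).image (fun i => ({i} : Finset (Fin m))) := if_pos hj
          rw [if_pos hj, ht, card_image_of_injective _ fun i i' h => singleton_injective h, card_univ, Fintype.card_fin]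
        · have ht : tgt j = {∅} := if_neg hj
          rw [if_neg hj, ht, card_singleton]
    _ = m ^ b.card := by rw [Fintype.prod_ite_mem, prod_const]

omit [DecidableEq V] [Fintype V] [Fintype S] in
/-- along ONE labelled family: with an activity bound `|w(H, Z)| ≤ M^{|H|}·u(Z)` on the polymers of `Q`, an ordered weak partition
`(H_i)` of `b` (`Σ_i |H_i| = |b|`) and clusters `Z_i ∈ Q` give `|Π_i w(H_i, Z_i)| ≤ M^{|b|}·Π_i u(Z_i)`. [cite: BalabanImbrieJaffe1988, p.310 (Sect. 5.14)] -/
theorem abs_wprod_le {u : Finset V → ℝ} {M : ℝ} (hw : ∀ H : Finset S, ∀ Z ∈ Q, |w H Z| ≤ M ^ H.card * u Z)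
    {ι : Type*} [Fintype ι] {b : Finset S} {Hs : ι → Finset S} {Z : ι → Finset V} (howp : OWP b Hs) (hZ : InQ Q Z) :
    |wprod w Hs Z| ≤ M ^ b.card * ∏ i, u (Z i) := by
  classical
  have hbsum : ∑ i, (Hs i).card = b.card := by
    rw [← howp.2, card_biUnion fun i _ i' _ hne => howp.1 i i' hne]
  unfold wprod
  rw [abs_prod]
  calc ∏ i, |w (Hs i) (Z i)| ≤ ∏ i, (M ^ (Hs i).card * u (Z i)) :=
        prod_le_prod (fun i _ => abs_nonneg _) fun i _ => hw (Hs i) (Z i) (hZ i)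
    _ = M ^ b.card * ∏ i, u (Z i) := by
        rw [prod_mul_distrib, prod_pow_eq_pow_sum, hbsum]

/-! ## §2 Steps (a)–(c): the connected term with `m` clusters against the tree-graph sum -/

/-- **STEPS (a)–(c) OF THE STANDARD EXERCISE ON A SUB-COLLECTION, ANY BOOKKEEPING**: with `|w(H, Z)| ≤ M^{|H|}·u(Z)` on `Q`, `u ≥ 0`, `M ≥ 0`,
`|Traw_m(b)| ≤ M^{|b|}·|b|!·Σ_{Z ∈ Q^m} |ρ^T(Z)|·Π_i (e·u(Z_i))` — the labelled structures number `≤ m^{|b|} ≤ |b|!·e^m`, one factor `e`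
per cluster. [cite: BalabanImbrieJaffe1988, p.310 (Sect. 5.14)] -/
theorem abs_Traw_le_of_actBound {u : Finset V → ℝ} {M : ℝ} (hM : 0 ≤ M) (hu : ∀ Z, 0 ≤ u Z)
    (hw : ∀ H : Finset S, ∀ Z ∈ Q, |w H Z| ≤ M ^ H.card * u Z) (b : Finset S) (m : ℕ) :
    |Traw Q loc w (Fin m) b| ≤ M ^ b.card * b.card.factorial *
      ∑ Z ∈ Fintype.piFinset (fun _ : Fin m => Q), |(rhoT Z univ : ℝ)| * ∏ i, (Real.exp 1 * u (Z i)) := by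
  classical
  have hB0 : ∀ Z : Fin m → Finset V, 0 ≤ M ^ b.card * (|(rhoT Z univ : ℝ)| * ∏ i, u (Z i)) :=
    fun Z => mul_nonneg (pow_nonneg hM _) (mul_nonneg (abs_nonneg _) (prod_nonneg fun i _ => hu _))
  -- (1) one labelled family
  have hfam : ∀ (Hs : Fin m → Finset S) (Z : Fin m → Finset V),
      |(if OWP b Hs ∧ InQ Q Z ∧ Cov loc Hs Z then (rhoT Z univ : ℝ) * wprod w Hs Z else 0)| ≤
        (if InQ Q Z then 1 else 0) * ((if OWP b Hs then 1 else 0) * (M ^ b.card * (|(rhoT Z univ : ℝ)| * ∏ i, u (Z i)))) := by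
    intro Hs Z
    by_cases h : OWP b Hs ∧ InQ Q Z ∧ Cov loc Hs Z
    · obtain ⟨howp, hQ, hcov⟩ := h
      rw [if_pos ⟨howp, hQ, hcov⟩, if_pos hQ, if_pos howp, one_mul, one_mul, abs_mul]
      calc |(rhoT Z univ : ℝ)| * |wprod w Hs Z| ≤ |(rhoT Z univ : ℝ)| * (M ^ b.card * ∏ i, u (Z i)) :=
            mul_le_mul_of_nonneg_left (abs_wprod_le hw howp hQ) (abs_nonneg _)
        _ = M ^ b.card * (|(rhoT Z univ : ℝ)| * ∏ i, u (Z i)) := by ring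
    · rw [if_neg h, abs_zero]
      exact mul_nonneg (by split_ifs <;> norm_num) (mul_nonneg (by split_ifs <;> norm_num) (hB0 Z))
  -- (2) the count of the labelled structures, (3) the tuples
  have hcount : (((univ : Finset (Fin m → Finset S)).filter fun Hs => OWP b Hs).card : ℝ) ≤
      b.card.factorial * Real.exp m := by
    have h := Real.pow_div_factorial_le_exp (x := (m : ℝ)) (Nat.cast_nonneg m) b.card
    rw [div_le_iff₀ (by positivity)] at h
    calc (((univ : Finset (Fin m → Finset S)).filter fun Hs => OWP b Hs).card : ℝ) ≤ (m : ℝ) ^ b.card := by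
          exact_mod_cast card_filter_owp_le b m
      _ ≤ Real.exp m * b.card.factorial := h
      _ = b.card.factorial * Real.exp m := mul_comm _ _
  unfold Traw
  calc |∑ Hs : Fin m → Finset S, ∑ Z : Fin m → Finset V,
          (if OWP b Hs ∧ InQ Q Z ∧ Cov loc Hs Z then (rhoT Z univ : ℝ) * wprod w Hs Z else 0)|
      ≤ ∑ Hs : Fin m → Finset S, |∑ Z : Fin m → Finset V,
          (if OWP b Hs ∧ InQ Q Z ∧ Cov loc Hs Z then (rhoT Z univ : ℝ) * wprod w Hs Z else 0)| :=
        abs_sum_le_sum_abs _ _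
    _ ≤ ∑ Hs : Fin m → Finset S, ∑ Z : Fin m → Finset V,
          |(if OWP b Hs ∧ InQ Q Z ∧ Cov loc Hs Z then (rhoT Z univ : ℝ) * wprod w Hs Z else 0)| :=
        sum_le_sum fun Hs _ => abs_sum_le_sum_abs _ _
    _ = ∑ Z : Fin m → Finset V, ∑ Hs : Fin m → Finset S,
          |(if OWP b Hs ∧ InQ Q Z ∧ Cov loc Hs Z then (rhoT Z univ : ℝ) * wprod w Hs Z else 0)| :=
        sum_comm
    _ ≤ ∑ Z : Fin m → Finset V, ∑ Hs : Fin m → Finset S,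
          (if InQ Q Z then 1 else 0) * ((if OWP b Hs then 1 else 0) * (M ^ b.card * (|(rhoT Z univ : ℝ)| * ∏ i, u (Z i)))) :=
        sum_le_sum fun Z _ => sum_le_sum fun Hs _ => hfam Hs Z
    _ = ∑ Z : Fin m → Finset V, (if InQ Q Z then 1 else 0) *
          ((((univ : Finset (Fin m → Finset S)).filter fun Hs => OWP b Hs).card : ℝ) *
            (M ^ b.card * (|(rhoT Z univ : ℝ)| * ∏ i, u (Z i)))) := by
        refine sum_congr rfl fun Z _ => ?_
        rw [← mul_sum, ← sum_mul, ← sum_filter, sum_const, nsmul_eq_mul, mul_one]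
    _ ≤ ∑ Z : Fin m → Finset V, (if InQ Q Z then 1 else 0) *
          ((b.card.factorial * Real.exp m) * (M ^ b.card * (|(rhoT Z univ : ℝ)| * ∏ i, u (Z i)))) :=
        sum_le_sum fun Z _ => mul_le_mul_of_nonneg_left (mul_le_mul_of_nonneg_right hcount (hB0 Z))
          (by split_ifs <;> norm_num)
    _ = ∑ Z ∈ Fintype.piFinset (fun _ : Fin m => Q),
          (b.card.factorial * Real.exp m) * (M ^ b.card * (|(rhoT Z univ : ℝ)| * ∏ i, u (Z i))) := by
        rw [piFinset_eq_filter_inQ, sum_filter]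
        refine sum_congr rfl fun Z _ => ?_
        split_ifs <;> simp
    _ = M ^ b.card * b.card.factorial *
          ∑ Z ∈ Fintype.piFinset (fun _ : Fin m => Q), |(rhoT Z univ : ℝ)| * ∏ i, (Real.exp 1 * u (Z i)) := by
        rw [mul_sum]
        refine sum_congr rfl fun Z _ => ?_
        rw [prod_mul_distrib, prod_const, card_univ, Fintype.card_fin, Real.exp_one_pow]
        ring

/-! ## §3 Step (d): Penrose's tree-graph inequality and the tuple summation ([Dimock2013] App. B engine) -/

/-- **THE STANDARD EXERCISE FOR THE CONNECTED SERIES, ANY BOOKKEEPING** (p. 310: *"It is now a standard exercise to estimate the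
expansion"*): under the activity bound `|w(H, Z)| ≤ M^{|H|}·u(Z)` on `Q` (`u ≥ 0`, `M ≥ 0`) and Dimock's tree-graph hypotheses for the weight
`e·u` and a volume `vol ≥ 0` — vertex `Σ_{X ∈ Q: X ∩ X′ ≠ ∅} e·u(X)·vol(X)^k ≤ k!·A·vol(X′)`, root `Σ_{X∈Q} e·u(X)·vol(X)^k ≤ k!·A·B`, `A ≤ 1/8` —
every partial sum of `Σ_m |Tord_m(b)|`, `b ≠ ∅`, is at most `M^{|b|}·|b|!·2AB` (step (d): Penrose's tree-graph inequality and the tuple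
summation, `Dimock2011to13.TreeGraphSummation.hstar_partialSum_le`). [cite: BalabanImbrieJaffe1988, p.310 (Sect. 5.14)] -/
theorem sum_abs_Tord_le_of_treeHyp {u vol : Finset V → ℝ} {M A B : ℝ} (hM : 0 ≤ M) (hu : ∀ Z, 0 ≤ u Z)
    (hw : ∀ H : Finset S, ∀ Z ∈ Q, |w H Z| ≤ M ^ H.card * u Z) (hvol : ∀ Z ∈ Q, 0 ≤ vol Z) (hA : 0 ≤ A) (hB : 0 ≤ B)
    (hA8 : A ≤ 1 / 8)
    (H1 : ∀ X' ∈ Q, ∀ k : ℕ, ∑ X ∈ Q with ¬ Disjoint X X', Real.exp 1 * u X * vol X ^ k ≤ k.factorial * A * vol X')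
    (H0 : ∀ k : ℕ, ∑ X ∈ Q, Real.exp 1 * u X * vol X ^ k ≤ k.factorial * A * B) {b : Finset S} (hb : b.Nonempty) (N : ℕ) :
    ∑ m ∈ range N, |Tord Q loc w m b| ≤ M ^ b.card * b.card.factorial * (2 * A * B) := by
  have hC0 : 0 ≤ M ^ b.card * (b.card.factorial : ℝ) := by positivity
  have hrhs : 0 ≤ M ^ b.card * b.card.factorial * (2 * A * B) := by positivity
  cases N with
  | zero => simpa using hrhs
  | succ N =>
    rw [sum_range_succ', Tord_zero _ _ _ hb, abs_zero, add_zero]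
    calc ∑ n ∈ range N, |Tord Q loc w (n + 1) b|
        = ∑ n ∈ range N, (1 / ((n + 1).factorial : ℝ)) * |Traw Q loc w (Fin (n + 1)) b| := by
          refine sum_congr rfl fun n _ => ?_
          unfold Tord
          rw [abs_div, Nat.abs_cast, div_eq_mul_one_div, mul_comm]
      _ ≤ ∑ n ∈ range N, (1 / ((n + 1).factorial : ℝ)) * (M ^ b.card * b.card.factorial *
            ∑ Z ∈ Fintype.piFinset (fun _ : Fin (n + 1) => Q), |(rhoT Z univ : ℝ)| * ∏ i, (Real.exp 1 * u (Z i))) :=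
          sum_le_sum fun n _ => mul_le_mul_of_nonneg_left (abs_Traw_le_of_actBound hM hu hw b (n + 1)) (by positivity)
      _ = M ^ b.card * b.card.factorial * ∑ n ∈ range N, ((1 / ((n + 1).factorial : ℝ)) *
            ∑ Z ∈ Fintype.piFinset (fun _ : Fin (n + 1) => Q), |(rhoT Z univ : ℝ)| * ∏ i, (Real.exp 1 * u (Z i))) := by
          rw [mul_sum]
          exact sum_congr rfl fun n _ => by ring
      _ ≤ M ^ b.card * b.card.factorial * (2 * A * B) :=
          mul_le_mul_of_nonneg_left (hstar_partialSum_le (w := fun Z => Real.exp 1 * u Z)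
            (fun Z _ => mul_nonneg (Real.exp_nonneg 1) (hu Z)) hvol hA hB hA8 H1 H0 N) hC0

/-- **… hence the connected series of every nonempty sub-collection converges absolutely** (the hypothesis `hT` of
`BIJ88ConnectedGraphResummation.display3` / `BIJ88RemainderW6Tsum.display2_Tsum`, any bookkeeping). [cite: BalabanImbrieJaffe1988, p.310 (Sect. 5.14)] -/
theorem summable_norm_Tord_of_treeHyp {u vol : Finset V → ℝ} {M A B : ℝ} (hM : 0 ≤ M) (hu : ∀ Z, 0 ≤ u Z)
    (hw : ∀ H : Finset S, ∀ Z ∈ Q, |w H Z| ≤ M ^ H.card * u Z) (hvol : ∀ Z ∈ Q, 0 ≤ vol Z) (hA : 0 ≤ A) (hB : 0 ≤ B)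
    (hA8 : A ≤ 1 / 8)
    (H1 : ∀ X' ∈ Q, ∀ k : ℕ, ∑ X ∈ Q with ¬ Disjoint X X', Real.exp 1 * u X * vol X ^ k ≤ k.factorial * A * vol X')
    (H0 : ∀ k : ℕ, ∑ X ∈ Q, Real.exp 1 * u X * vol X ^ k ≤ k.factorial * A * B) {b : Finset S} (hb : b.Nonempty) :
    Summable fun m => ‖Tord Q loc w m b‖ := by
  have h := summable_of_sum_range_le (fun _ => abs_nonneg _)
    (sum_abs_Tord_le_of_treeHyp (loc := loc) hM hu hw hvol hA hB hA8 H1 H0 hb)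
  simpa only [Real.norm_eq_abs] using h

/-- **… and the truncated function is bounded**: `|T(b)| ≤ M^{|b|}·|b|!·2AB` (p. 310: *"The result is |W₆^{(k)′}(X)| ≤ …"* is assembled from
such block bounds). [cite: BalabanImbrieJaffe1988, p.310 (Sect. 5.14)] -/
theorem abs_Tsum_le_of_treeHyp {u vol : Finset V → ℝ} {M A B : ℝ} (hM : 0 ≤ M) (hu : ∀ Z, 0 ≤ u Z)
    (hw : ∀ H : Finset S, ∀ Z ∈ Q, |w H Z| ≤ M ^ H.card * u Z) (hvol : ∀ Z ∈ Q, 0 ≤ vol Z) (hA : 0 ≤ A) (hB : 0 ≤ B)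
    (hA8 : A ≤ 1 / 8)
    (H1 : ∀ X' ∈ Q, ∀ k : ℕ, ∑ X ∈ Q with ¬ Disjoint X X', Real.exp 1 * u X * vol X ^ k ≤ k.factorial * A * vol X')
    (H0 : ∀ k : ℕ, ∑ X ∈ Q, Real.exp 1 * u X * vol X ^ k ≤ k.factorial * A * B) {b : Finset S} (hb : b.Nonempty) :
    |Tsum Q loc w b| ≤ M ^ b.card * b.card.factorial * (2 * A * B) := by
  have hle := sum_abs_Tord_le_of_treeHyp (loc := loc) hM hu hw hvol hA hB hA8 H1 H0 hb
  have hs : Summable fun m => ‖Tord Q loc w m b‖ := summable_norm_Tord_of_treeHyp hM hu hw hvol hA hB hA8 H1 H0 hb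
  calc |Tsum Q loc w b| = ‖∑' m, Tord Q loc w m b‖ := (Real.norm_eq_abs _).symm
    _ ≤ ∑' m, ‖Tord Q loc w m b‖ := norm_tsum_le_tsum_norm hs
    _ ≤ M ^ b.card * b.card.factorial * (2 * A * B) :=
        Real.tsum_le_of_sum_range_le (fun _ => norm_nonneg _) fun N => by simpa only [Real.norm_eq_abs] using hle N



end Literature.MathematicalPhysics.QuantumFieldTheory.BalabanImbrieJaffe1984to88.BIJ88ConnectedGraphTreeBound

end
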